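import Summits.FinalStateConjecture.FinalStateConjecture.Theses.PhaseMixingCapture
import Summits.FinalStateConjecture.FinalStateConjecture.Theorems.PhaseMixingCaptureCaptureSufficesReduction
import Summits.FinalStateConjecture.FinalStateConjecture.Theorems.PhaseMixingCaptureBulkKerrCaptureC2OfClaim
import Summits.FinalStateConjecture.FinalStateConjecture.Theorems.BulkKerrCapture.Negative.LineStubs
import Summits.FinalStateConjecture.FinalStateConjecture.Theorems.NearExtremalKappaCapture.Negative.ExponentMonotonicity
import Literature.Geometry.Lorentzian.KerrStabilitySubextremalCauchy
import HarnessLib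

/-!
# Disproof of `BulkKerrCaptureC2` — findings (crux `stmt-FinalStateConjecture-14985`,
route `PhaseMixingCapture`, rank 4; standing disprover `cdisprove`, cycle 1, 2026-08-16)

**Verdict, cycle 1: NO KILL — and none is available from this side without an object the tree
cannot construct.** `BulkKerrCaptureC2` is the import-grade successor of `BulkKerrCapture`
(predecessor work file `Cruxes/BulkKerrCapture/Disproof.lean`, g1–g3, NO KILL; its landed
`Theorems/BulkKerrCapture/Negative/*` is imported and reused here): b-conormal side condition
`∀ s', dist_{s',δ} < ⊤`, qualitative modulus `∀ η ∃ ε`, convergence order PINNED to `k = 2`. It is,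
modulo a Lebesgue number, the claim-tagged Literature fact
`hintz_kerr_stability_subextremal_cauchy_allOrders` (Hintz, arXiv:2606.28253v2, Thm. 13.1 + (13.2)
+ Rem. 13.2, UNREFEREED, `@[claim "Hintz2026" "under-review"]`) at the unit leaf `ρ₀ = 1` and
order `k = 2`: the picked line `SketchStandalone` is COMPLETE modulo that claim (§7:
`stub_hintzClaimAllOrders` is DEFINITIONALLY the named claim — `stub1_iff_claim`, `Iff.rfl` —
and `stub_c2Far_of_allOrdersBody` is landed, p96721; the composition smuggles nothing).

## Why it resists (numbers, not adjectives)

1. **Every refutation needs ONE maximal vacuum Cauchy development violating the conclusion**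
   (`not_bulkKerrCaptureC2_iff`, `not_bulkKerrCaptureC2_of_kerrData_mghd`): maximality
   (`VacuumCauchyDevelopment.IsMaximal` = every vacuum Cauchy development embeds) is the
   Choquet-Bruhat–Geroch theorem, a named fact (`choquetBruhat_geroch_exists_mghd_cauchy`) with no
   constructible instance; and no bad development of near-Kerr data is expected to exist — the full
   sub-extremal range is Hintz's Thm. 13.1, the Schwarzschild / slowly rotating centres are the
   REFEREED Klainerman–Szeftel 2023 / GKS 2022 / DHRT 2021 theorems, no nonlinear instability
   mechanism of a vacuum sub-extremal Kerr exterior in 3+1 dimensions is known or conjectured, and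
   the catalogued barriers (`Literature/Barriers/FinalStateConjecture/`: Aretakis at `|a| = M`,
   massive-field superradiance / hair, Gregory–Laflamme strings, naked singularities, the
   slowly-rotating frontier) do not touch it (the frontier is evaded only by importing the claim).
2. **Junk audit of what is NEW relative to `BulkKerrCapture` — all honest.** (a) `k = 2`:
   `Spacetime.ConvergesTo B 𝒟oc 2` asks a smooth late chart `Ψ` (open embedding of
   `{x⁰ > τ₀, r > r₊(M',a')}`) with `supC²ENorm` of `Ψ^*g − g_{M',a'}` over the FULL slabs
   `{x⁰ = τ}` (out to `i⁰`) tending to `0`; `iteratedFDeriv` is local and the slabs lie in the open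
   exterior, `Ψ` and `g` are smooth, the deviation can vanish identically (identity chart on exact
   Kerr) — no junk truth or falsity; `𝒟oc` existential still discharges the covering clause of
   `IsLateEmbedding` with `𝒟oc := Ψ '' lateRegion` (a weakness for the consumer, not a falsity).
   (b) b-conormality at ONE weight `δ` for all orders `s'`: satisfied by the centre (`dist_self = 0`)
   and by every compactly supported smooth perturbation; `(s, δ)` existential and the block is an
   UP-SET in `(s, δ)` (`CaptureC2At.mono`), so nothing degenerates for large exponents.
   (c) `∀ η ∃ ε`: consistent at every centre with `|a| ≤ M` (`subextremal_near_of_abs_le`).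
3. **What changed for the adversary.** The predecessor's load-bearing lemmas killed the closed-range
   (`a₁ ≤ 1`) and massless (`0 ≤ M`) members by PINNING `(M', a') = (M, a)` through the modulus at
   the centre. Under `∀ η ∃ ε` pinning is gone: those members are now refutable only modulo
   `C²` KERR-LIMIT RIGIDITY (`BulkKerrCapture.Negative.KerrLimitRigidity 2`; §5, §8). The pinned
   order `k = 2` is exactly what makes rigidity a CURVATURE statement (`C²`-closeness of `Ψ^*g` to
   `g_{M',a'}` controls `Riem`; a flat or extremal development cannot `C²`-converge to a sub-extremal
   `g_{M',a'}` with `M' > 0`) — but proving it needs (i) curvature naturality under pullback, (ii)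
   non-vanishing Kerr curvature for all sub-extremal `(M', a')`, (iii) CBG uniqueness to know the
   geometry of an abstract maximal development: none in the tree (§8, near-miss, `sorry`).
   Above the boundary (`a₁ > 1`, a super-extremal centre) counting still kills
   (`captureC2Family_false_of_one_lt`, modulo CBG + the constraints of that datum).
4. **Where a kill could still come from** (for reviewers of the CLAIM, not of Hintz's theorem): the
   consequence-form translation recorded in the docstring of
   `hintz_kerr_stability_subextremal_cauchy(_allOrders)`, paraphrase notes (γ), (ε) and the slab
   geometry. (a) The tree's slabs `{x⁰ = τ}` (ingoing Kerr–Schild time) reach `i⁰` with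
   `t_BL = τ − 2M log(r/2M − 1) → −∞`, whereas Hintz's `Ω = {t̃ ≥ 0, r ≥ m₀}` is bounded in the
   past by `Σ = t̃⁻¹(0)`, an `O(log r)`-bent BL slice (§5.7.1; `Cruxes/BulkKerrCapture/NOTES.md`
   reads Lemma 3.7/(3.18) as `𝔱 = t_* + r`, bending to the FUTURE): each tree slab LEAVES `Ω` beyond
   `r ≈ 2M e^{(τ+C)/4M}`, so the late chart of `ConvergesToKerr` must be continued through the
   sliver between the Kerr–Schild leaf and `Σ` near `i⁰` (where the solution is the boost-theorem
   development of the far data, `O(M/r) = O(e^{−τ/4M})`-close to flat) — soft, unprinted, and the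
   frame mismatch (Hintz's co-moving coordinates vs the initial asymptotic frame differ by the small
   boost `S`) is harmless for the DEVIATION (both frames pull `g` back to `η + O(M/r)`) but not for
   a naive interpolation of charts (error `∼ |S| · r · |ds|`). (b) Data on `{t* = 0}` vs `Σ_IVP`
   (γ): the b-conormal `H^s_δ` class must be transported across the conic region `U_δ` ([COM81]
   step, printed as a remark). (c) `C²`-sup on full slabs from the `H_b^∞` membership (13.2) and
   rates (1)–(4): fine (b-Sobolev embedding loses no weight; Cartesian derivatives gain `r⁻¹` over
   b-derivatives at `i⁰` and are `∂_u`-dominated, `O(r⁻¹)`, near `𝓘⁺`). None of (a)–(c) is a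
   refutation; they are the three places where the typed claim exceeds the printed text.

## Contents (everything below is kernel-checked unless marked `sorry`)

* §1–§4 block form `CaptureC2At`, prefix normal forms, centre lemmas, degenerate centres —
  LANDED as `Theorems/BulkKerrCaptureC2/Negative/BlockForm.lean` (p99148, ACCEPTED, commit 01abd5044f03).
* §5–§6 `CaptureC2Family`, load-bearing lemmas modulo named facts, kill templates — LANDED as
  `Theorems/BulkKerrCaptureC2/Negative/LoadBearing.lean` (p100887, ACCEPTED).
* §7 `-- Line SketchStandalone`: `stub1_iff_claim` (`Iff.rfl`), `bulkKerrCaptureC2_of_claim`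
  (the crux from the NAMED claim via the landed stub 2), `bulkKerrCaptureC2_pointwise` (the crux
  implies the `k = 2` pointwise claim shape at the unit leaf: it sits between
  `…_allOrders.atUnitLeaf` and `…_allOrders.orderTwo` at `ρ₀ = 1`; its only content beyond the
  pointwise `k = 2` claim is LOCAL UNIFORMITY of `(s, δ, ε)` in the spin, Rem. 13.2).
* §8 near-miss (sorry): `kerrLimitRigidity_two` — what would make §5 unconditional modulo CBG.

Attacks run this cycle (all negative): junk audit of `ConvergesTo … 2` / `IsLateEmbedding` /
`deviationCk` / `supCkENorm` (KerrConvergence.lean ll. 330–520), of `IsMaximal` / `EmbedsInto`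
(CauchyDevelopment.lean ll. 150–330), of the conormal side condition and the `(s, δ)` direction;
degenerate centres `a₁ < 0` (vacuous), `a₁ = 0` (Schwarzschild = KS2023), `a₁ ↑ 1`, `a = ±M`,
`M = 0`, `a₁ > 1`; quantifier mutations `∃ ε ∀ η` / `η = 0` / all-origin completeness / `ε`
uniform in `M` (each false on paper, none formalisable without a development); triviality probes
(`aesop`/`simp` on the block: fail, W.lean); literature: no sub-extremal vacuum instability in print
(grounder notes g39-17/22; `lit search` degraded this session, searchd rc 75).
-/

-- the doubled `FinalStateConjecture.FinalStateConjecture` path component trips dupNamespace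
set_option linter.dupNamespace false

noncomputable section

open Set Filter Topology Function
open scoped Manifold ContDiff ENNReal Topology
open Literature.Geometry.Lorentzian
open Summit.FinalStateConjecture.FinalStateConjecture.Theses.PhaseMixingCapture (BulkKerrCaptureC2)
open Summit.FinalStateConjecture.FinalStateConjecture.Theorems
open Summit.FinalStateConjecture.FinalStateConjecture.Theorems.BulkKerrCapture

namespace Summit.FinalStateConjecture.FinalStateConjecture.Cruxes.BulkKerrCaptureC2.Disproof

/-! ## §1 The conclusion block with parameters exposed -/

/-- `CaptureC2At s δ M hM ε η a`: every vacuum-constraint solution `D` on `Kerr.slice a M` which is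
b-conormal relative to `Kerr.data M a M` at weight `δ` (finite `H^{s'}_δ`-distance at every order
`s'`) and within `H^s_δ`-distance `ε` of it has all its maximal vacuum Cauchy developments
far-complete (`DataEmbedding.HasCompleteFutureNullInfinityFar`), with a region converging in `C²`
to a sub-extremal `g_{M',a'}`, `|M' − M| + |a' − a| ≤ η`. The matrix of the crux
`BulkKerrCaptureC2`; a parametrised predicate, not a named fact. [folklore] -/
def CaptureC2At [Kerr.Facts] [Kerr.SliceFacts] (s : ℕ) (δ : ℝ) (M : ℝ) (hM : 0 ≤ M)
    (ε η a : ℝ) : Prop :=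
  ∀ (D : InitialDataSet 𝓘(ℝ, E3) (Kerr.slice a M)) [D.metric.HasLeviCivita],
    D.IsVacuumConstraintSolution →
    (∀ s' : ℕ, InitialDataSet.dataWeightedSobolevEDist s' δ D (Kerr.data M a M hM) < ⊤) →
    InitialDataSet.dataWeightedSobolevEDist s δ D (Kerr.data M a M hM) < ENNReal.ofReal ε →
    ∀ 𝒟 : VacuumCauchyDevelopment D, 𝒟.IsMaximal →
      ∃ (M' a' : ℝ) (𝒟oc : Set 𝒟.carrier), Kerr.IsSubextremal M' a' ∧
        𝒟.HasCompleteFutureNullInfinityFar ∧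
        𝒟.toSpacetime.ConvergesToKerr 𝒟oc M' a' 2 ∧ |M' - M| + |a' - a| ≤ η

/-- **The crux in block form**: `BulkKerrCaptureC2` iff for every `a₁ < 1` there are `(s, δ)` and,
per mass `M > 0` and tolerance `η > 0`, one basin `ε > 0` with `CaptureC2At s δ M _ ε η a` for every
`|a| ≤ a₁ M` (the tree lemma `PhaseMixingCaptureCaptureSuffices.bulkKerrCaptureC2_iff` read through
`CaptureC2At`). [folklore] -/
theorem bulkKerrCaptureC2_iff_captureC2At :
    BulkKerrCaptureC2 ↔
      ∀ [Kerr.Facts] [Kerr.SliceFacts], ∀ a₁ : ℝ, a₁ < 1 → ∃ (s : ℕ) (δ : ℝ),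
        ∀ (M : ℝ) (hM : 0 < M), ∀ η > (0 : ℝ), ∃ ε > (0 : ℝ), ∀ a : ℝ, |a| ≤ a₁ * M →
          CaptureC2At s δ M hM.le ε η a := by
  rw [PhaseMixingCaptureCaptureSuffices.bulkKerrCaptureC2_iff]
  rfl

/-! ## §2 Structure of the quantifier prefix -/

/-- **Monotonicity of the block.** `CaptureC2At` is an up-set in `(s, δ)` (raising the order or
the weight shrinks the data class: the data distance is monotone in both exponents,
`NearExtremalKappaCapture.Negative.dataWeightedSobolevEDist_mono`), antitone in the basin `ε` and
monotone in the tolerance `η`. [folklore] -/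
theorem CaptureC2At.mono [Kerr.Facts] [Kerr.SliceFacts] {s s' : ℕ} {δ δ' : ℝ} {M : ℝ}
    {hM : 0 ≤ M} {ε ε' η η' a : ℝ} (h : CaptureC2At s δ M hM ε η a) (hs : s ≤ s') (hδ : δ ≤ δ')
    (hε : ε' ≤ ε) (hη : η ≤ η') : CaptureC2At s' δ' M hM ε' η' a := by
  intro D _ hvac hcon hdist 𝒟 hmax
  have hcon' : ∀ s'' : ℕ,
      InitialDataSet.dataWeightedSobolevEDist s'' δ D (Kerr.data M a M hM) < ⊤ := fun s'' ↦
    lt_of_le_of_lt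
      (NearExtremalKappaCapture.Negative.dataWeightedSobolevEDist_mono le_rfl hδ D _) (hcon s'')
  have hdist' : InitialDataSet.dataWeightedSobolevEDist s δ D (Kerr.data M a M hM) <
      ENNReal.ofReal ε :=
    lt_of_le_of_lt (NearExtremalKappaCapture.Negative.dataWeightedSobolevEDist_mono hs hδ D _)
      (hdist.trans_le (ENNReal.ofReal_le_ofReal hε))
  obtain ⟨M', a', 𝒟oc, hsub, hfar, hconv, hpar⟩ := h D hvac hcon' hdist' 𝒟 hmax
  exact ⟨M', a', 𝒟oc, hsub, hfar, hconv, hpar.trans hη⟩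

/-- WLOG `0 ≤ a₁`: the crux is equivalent to its restriction to thresholds `a₁ ∈ [0, 1)` (for
`a₁ < 0` the spin range `|a| ≤ a₁ M`, `M > 0`, is empty: `BulkKerrCapture.Negative.no_spin_of_neg`).
[folklore] -/
theorem bulkKerrCaptureC2_iff_nonneg :
    BulkKerrCaptureC2 ↔
      ∀ [Kerr.Facts] [Kerr.SliceFacts], ∀ a₁ : ℝ, 0 ≤ a₁ → a₁ < 1 → ∃ (s : ℕ) (δ : ℝ),
        ∀ (M : ℝ) (hM : 0 < M), ∀ η > (0 : ℝ), ∃ ε > (0 : ℝ), ∀ a : ℝ, |a| ≤ a₁ * M →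
          CaptureC2At s δ M hM.le ε η a := by
  rw [bulkKerrCaptureC2_iff_captureC2At]
  constructor
  · intro h _ _ a₁ _ ha₁
    exact h a₁ ha₁
  · intro h _ _ a₁ ha₁
    rcases le_or_gt 0 a₁ with h0 | h0
    · exact h a₁ h0 ha₁
    · exact ⟨0, 0, fun M hM η _ ↦ ⟨1, one_pos, fun a ha ↦ (Negative.no_spin_of_neg h0 hM ha).elim⟩⟩

/-- **Normal form.** For ANY prescribed `(s₀, δ₀)` and `η₀ > 0`, the crux is equivalent to its
restriction to exponents `s ≥ s₀`, `δ ≥ δ₀`, basins `ε ≤ 1` and SMALL tolerances `η ≤ η₀`: the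
existential `(s, δ)` may be taken above any Sobolev/decay threshold (the crux IS its own
high-regularity, fast-decay member), and only small tolerances carry content. [folklore] -/
theorem bulkKerrCaptureC2_iff_normalForm (s₀ : ℕ) (δ₀ : ℝ) {η₀ : ℝ} (hη₀ : 0 < η₀) :
    BulkKerrCaptureC2 ↔
      ∀ [Kerr.Facts] [Kerr.SliceFacts], ∀ a₁ : ℝ, 0 ≤ a₁ → a₁ < 1 → ∃ s ≥ s₀, ∃ δ ≥ δ₀,
        ∀ (M : ℝ) (hM : 0 < M), ∀ η : ℝ, 0 < η → η ≤ η₀ → ∃ ε > (0 : ℝ), ε ≤ 1 ∧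
          ∀ a : ℝ, |a| ≤ a₁ * M → CaptureC2At s δ M hM.le ε η a := by
  rw [bulkKerrCaptureC2_iff_nonneg]
  constructor
  · intro h _ _ a₁ h0 ha₁
    obtain ⟨s, δ, hsδ⟩ := h a₁ h0 ha₁
    refine ⟨max s s₀, le_max_right _ _, max δ δ₀, le_max_right _ _, fun M hM η hη _ ↦ ?_⟩
    obtain ⟨ε, hε, hcap⟩ := hsδ M hM η hη
    refine ⟨min ε 1, lt_min hε one_pos, min_le_right _ _, fun a ha ↦ ?_⟩
    exact (hcap a ha).mono (le_max_left _ _) (le_max_left _ _) (min_le_left _ _) le_rfl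
  · intro h _ _ a₁ h0 ha₁
    obtain ⟨s, -, δ, -, hsδ⟩ := h a₁ h0 ha₁
    refine ⟨s, δ, fun M hM η hη ↦ ?_⟩
    obtain ⟨ε, hε, -, hcap⟩ := hsδ M hM (min η η₀) (lt_min hη hη₀) (min_le_right _ _)
    exact ⟨ε, hε, fun a ha ↦ (hcap a ha).mono le_rfl le_rfl le_rfl (min_le_left _ _)⟩

/-- **The threshold is antitone**: the member of the crux at threshold `a₁` implies the member at
every `a₁' ≤ a₁` (same witnesses; the spin range shrinks). [folklore] -/
theorem captureC2Threshold_anti [Kerr.Facts] [Kerr.SliceFacts] {a₁ a₁' : ℝ} (hle : a₁' ≤ a₁)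
    (h : ∃ (s : ℕ) (δ : ℝ), ∀ (M : ℝ) (hM : 0 < M), ∀ η > (0 : ℝ), ∃ ε > (0 : ℝ), ∀ a : ℝ,
      |a| ≤ a₁ * M → CaptureC2At s δ M hM.le ε η a) :
    ∃ (s : ℕ) (δ : ℝ), ∀ (M : ℝ) (hM : 0 < M), ∀ η > (0 : ℝ), ∃ ε > (0 : ℝ), ∀ a : ℝ,
      |a| ≤ a₁' * M → CaptureC2At s δ M hM.le ε η a := by
  obtain ⟨s, δ, hsδ⟩ := h
  refine ⟨s, δ, fun M hM η hη ↦ ?_⟩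
  obtain ⟨ε, hε, hcap⟩ := hsδ M hM η hη
  exact ⟨ε, hε, fun a ha ↦ hcap a (ha.trans (mul_le_mul_of_nonneg_right hle hM.le))⟩

/-- **Countable normal form.** The crux is the conjunction of its members at the thresholds
`a₁ = 1 − 1/(n+1)`, `n : ℕ` (antitonicity in the threshold and the Archimedean property): a proof
may proceed threshold by threshold along ANY sequence `a₁ ↑ 1`, and a disproof must defeat ONE
threshold `a₁ < 1`. [folklore] -/
theorem bulkKerrCaptureC2_iff_seq :
    BulkKerrCaptureC2 ↔
      ∀ [Kerr.Facts] [Kerr.SliceFacts], ∀ n : ℕ, ∃ (s : ℕ) (δ : ℝ),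
        ∀ (M : ℝ) (hM : 0 < M), ∀ η > (0 : ℝ), ∃ ε > (0 : ℝ), ∀ a : ℝ,
          |a| ≤ (1 - 1 / ((n : ℝ) + 1)) * M → CaptureC2At s δ M hM.le ε η a := by
  rw [bulkKerrCaptureC2_iff_captureC2At]
  constructor
  · intro h _ _ n
    refine h _ ?_
    have : (0 : ℝ) < 1 / ((n : ℝ) + 1) := by positivity
    linarith
  · intro h _ _ a₁ ha₁
    obtain ⟨n, hn⟩ := exists_nat_one_div_lt (show 0 < 1 - a₁ by linarith)
    exact captureC2Threshold_anti (by linarith) (h n)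

/-! ## §3 The centre of the ball -/

/-- **Centre of the ball.** `CaptureC2At … ε η a` with `ε > 0`, applied to the exact Kerr datum
(distance `0` to itself, b-conormal trivially), yields: every MGHD of `Kerr.data M a M` is
far-complete and has a region converging in `C²` to SOME sub-extremal `g_{M',a'}` with
`|M' − M| + |a' − a| ≤ η`. Unlike the predecessor crux (`BulkKerrCapture.Negative.captureAt_atKerrData`,
modulus `C √dist`), the final parameters are NOT pinned to `(M, a)`. Only the vacuum constraints of
the one datum enter (`hvac`, the named fact `Kerr.data_isVacuumConstraintSolution` at `(M, a, M)`);
the Levi-Civita instance is the tree theorem `PseudoRiemannianMetric.hasLeviCivita`. [folklore] -/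
theorem captureC2At_atKerrData [Kerr.Facts] [Kerr.SliceFacts] {s : ℕ} {δ : ℝ} {M : ℝ}
    {hM : 0 ≤ M} {ε η a : ℝ} (hε : 0 < ε) (h : CaptureC2At s δ M hM ε η a)
    (hvac : Kerr.data_isVacuumConstraintSolution M a M)
    (𝒟 : VacuumCauchyDevelopment (Kerr.data M a M hM)) (hmax : 𝒟.IsMaximal) :
    𝒟.HasCompleteFutureNullInfinityFar ∧
      ∃ (M' a' : ℝ) (𝒟oc : Set 𝒟.carrier), Kerr.IsSubextremal M' a' ∧
        𝒟.toSpacetime.ConvergesToKerr 𝒟oc M' a' 2 ∧ |M' - M| + |a' - a| ≤ η := by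
  haveI := (Kerr.data M a M hM).metric.hasLeviCivita
  have hcon : ∀ s' : ℕ, InitialDataSet.dataWeightedSobolevEDist s' δ (Kerr.data M a M hM)
      (Kerr.data M a M hM) < ⊤ := fun s' ↦ by
    rw [InitialDataSet.dataWeightedSobolevEDist_self]
    exact ENNReal.zero_lt_top
  have h0 : InitialDataSet.dataWeightedSobolevEDist s δ (Kerr.data M a M hM)
      (Kerr.data M a M hM) < ENNReal.ofReal ε := by
    rw [InitialDataSet.dataWeightedSobolevEDist_self]
    exact ENNReal.ofReal_pos.2 hε
  obtain ⟨M', a', 𝒟oc, hsub, hfar, hconv, hpar⟩ := h _ (hvac hM) hcon h0 𝒟 hmax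
  exact ⟨hfar, M', a', 𝒟oc, hsub, hconv, hpar⟩

/-- **The crux at the centre of its ball.** `BulkKerrCaptureC2` implies: for every `M > 0` and
every sub-extremal spin `|a| < M` (threshold `a₁ := |a|/M`), every MGHD of the exact Kerr datum
on `{t* = 0, r > M}` is far-complete and, for EVERY tolerance `η > 0`, has a region converging in
`C²` to some sub-extremal `g_{M',a'}` with `|M' − M| + |a' − a| ≤ η` (the vacuum constraints of the
Kerr data enter as the hypothesis `hvac`, a named fact unproved in the tree for `a ≠ 0`). The
expected-true sanity statement at the centre; no refutation there. [folklore] -/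
theorem bulkKerrCaptureC2_atKerrData (h : BulkKerrCaptureC2) [Kerr.Facts] [Kerr.SliceFacts]
    (hvac : ∀ M a r₀ : ℝ, Kerr.data_isVacuumConstraintSolution M a r₀) {M a : ℝ} (hM : 0 < M)
    (ha : Kerr.IsSubextremal M a) (𝒟 : VacuumCauchyDevelopment (Kerr.data M a M hM.le))
    (hmax : 𝒟.IsMaximal) :
    𝒟.HasCompleteFutureNullInfinityFar ∧
      ∀ η > (0 : ℝ), ∃ (M' a' : ℝ) (𝒟oc : Set 𝒟.carrier), Kerr.IsSubextremal M' a' ∧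
        𝒟.toSpacetime.ConvergesToKerr 𝒟oc M' a' 2 ∧ |M' - M| + |a' - a| ≤ η := by
  rw [bulkKerrCaptureC2_iff_captureC2At] at h
  have ha₁ : |a| / M < 1 := by
    rw [div_lt_one hM]
    exact ha
  obtain ⟨s, δ, hsδ⟩ := h (|a| / M) ha₁
  have hspin : |a| ≤ |a| / M * M := by rw [div_mul_cancel₀ _ hM.ne']
  have key : ∀ η > (0 : ℝ), 𝒟.HasCompleteFutureNullInfinityFar ∧
      ∃ (M' a' : ℝ) (𝒟oc : Set 𝒟.carrier), Kerr.IsSubextremal M' a' ∧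
        𝒟.toSpacetime.ConvergesToKerr 𝒟oc M' a' 2 ∧ |M' - M| + |a' - a| ≤ η := fun η hη ↦ by
    obtain ⟨ε, hε, hcap⟩ := hsδ M hM η hη
    exact captureC2At_atKerrData hε (hcap a hspin) (hvac M a M) 𝒟 hmax
  exact ⟨(key 1 one_pos).1, fun η hη ↦ (key η hη).2⟩

/-- **The crux at the Schwarzschild centre, with NO named-fact hypothesis**: the `a = 0`
constraints are the tree theorem `Kerr.data_isVacuumConstraintSolution_zero`. For every `M > 0`,
every MGHD of the Schwarzschild datum on `{t* = 0, r > M}` is far-complete and, for every `η > 0`,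
`C²`-converges on some region to some sub-extremal `g_{M',a'}` with `|M' − M| + |a'| ≤ η`. [folklore] -/
theorem bulkKerrCaptureC2_atSchwarzschildData (h : BulkKerrCaptureC2) [Kerr.Facts]
    [Kerr.SliceFacts] {M : ℝ} (hM : 0 < M)
    (𝒟 : VacuumCauchyDevelopment (Kerr.data M 0 M hM.le)) (hmax : 𝒟.IsMaximal) :
    𝒟.HasCompleteFutureNullInfinityFar ∧
      ∀ η > (0 : ℝ), ∃ (M' a' : ℝ) (𝒟oc : Set 𝒟.carrier), Kerr.IsSubextremal M' a' ∧
        𝒟.toSpacetime.ConvergesToKerr 𝒟oc M' a' 2 ∧ |M' - M| + |a' - 0| ≤ η := by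
  rw [bulkKerrCaptureC2_iff_captureC2At] at h
  obtain ⟨s, δ, hsδ⟩ := h 0 one_pos
  have hspin : |(0 : ℝ)| ≤ 0 * M := by simp
  have key : ∀ η > (0 : ℝ), 𝒟.HasCompleteFutureNullInfinityFar ∧
      ∃ (M' a' : ℝ) (𝒟oc : Set 𝒟.carrier), Kerr.IsSubextremal M' a' ∧
        𝒟.toSpacetime.ConvergesToKerr 𝒟oc M' a' 2 ∧ |M' - M| + |a' - 0| ≤ η := fun η hη ↦ by
    obtain ⟨ε, hε, hcap⟩ := hsδ M hM η hη
    exact captureC2At_atKerrData hε (hcap 0 hspin) (Kerr.data_isVacuumConstraintSolution_zero M M)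
      𝒟 hmax
  exact ⟨(key 1 one_pos).1, fun η hη ↦ (key η hη).2⟩

/-! ## §4 Degenerate centres: the parameter clause alone is consistent -/

/-- **The pinning kills do not port.** Whenever `|a| ≤ M` — in particular at the EXTREMAL centre
`|a| = M` and at the MASSLESS centre `M = 0`, `a = 0` — the parameter clause of the conclusion,
"some sub-extremal `(M', a')` with `|M' − M| + |a' − a| ≤ η`", is satisfiable for every `η > 0`
(witness `(M + η/2, a)`). So under the `∀ η ∃ ε` typing the degenerate centres that refute the
closed-range and massless members of the predecessor family by pinning
(`BulkKerrCapture.Negative.captureAt_noMGHD_of_not_isSubextremal`) are no longer contradictory on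
their face: refuting those members of the `C²` family needs LIMIT RIGIDITY (§5). [folklore] -/
theorem subextremal_near_of_abs_le {M a η : ℝ} (ha : |a| ≤ M) (hη : 0 < η) :
    ∃ M' a' : ℝ, Kerr.IsSubextremal M' a' ∧ |M' - M| + |a' - a| ≤ η := by
  refine ⟨M + η / 2, a, ?_, ?_⟩
  · unfold Kerr.IsSubextremal
    linarith
  · rw [sub_self, abs_zero, add_zero, add_sub_cancel_left, abs_of_pos (by positivity)]
    linarith

/-- **Only a SUPER-extremal centre is excluded by counting**: if `M + η < |a|` then no
sub-extremal `(M', a')` is within `η` of `(M, a)`. [folklore] -/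
theorem not_exists_subextremal_near_of_lt {M a η : ℝ} (h : M + η < |a|) :
    ¬ ∃ M' a' : ℝ, Kerr.IsSubextremal M' a' ∧ |M' - M| + |a' - a| ≤ η := by
  rintro ⟨M', a', hsub, hpar⟩
  unfold Kerr.IsSubextremal at hsub
  have h1 : M' ≤ M + |M' - M| := by linarith [le_abs_self (M' - M)]
  have h2 : |a| ≤ |a'| + |a' - a| := by
    have := abs_sub_abs_le_abs_sub a a'
    rw [abs_sub_comm] at this
    linarith
  linarith

/-! ## §5 Load-bearing hypotheses: the two one-hypothesis weakenings -/

/-- **The crux family with its two side conditions exposed**: thresholds `a₁` range over `T ⊆ ℝ`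
and masses over `{M | 0 ≤ M ∧ P M}`; everything else verbatim (`CaptureC2At`). The crux is the
member `T = Iio 1`, `P = (0 < ·)` (`bulkKerrCaptureC2_iff_family`). A parametrised predicate, not a
named fact. [folklore] -/
def CaptureC2Family [Kerr.Facts] [Kerr.SliceFacts] (T : Set ℝ) (P : ℝ → Prop) : Prop :=
  ∀ a₁ ∈ T, ∃ (s : ℕ) (δ : ℝ), ∀ (M : ℝ) (hM : 0 ≤ M), P M → ∀ η > (0 : ℝ), ∃ ε > (0 : ℝ),
    ∀ a : ℝ, |a| ≤ a₁ * M → CaptureC2At s δ M hM ε η a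

/-- The family is antitone in the threshold set and in the mass predicate. [folklore] -/
theorem CaptureC2Family.anti [Kerr.Facts] [Kerr.SliceFacts] {T T' : Set ℝ} {P P' : ℝ → Prop}
    (h : CaptureC2Family T P) (hT : T' ⊆ T) (hP : ∀ M, P' M → P M) :
    CaptureC2Family T' P' := fun a₁ ha₁ ↦ by
  obtain ⟨s, δ, hsδ⟩ := h a₁ (hT ha₁)
  exact ⟨s, δ, fun M hM hPM ↦ hsδ M hM (hP M hPM)⟩

/-- **The crux is the member `T = Iio 1`, `P = (0 < ·)`.** [folklore] -/
theorem bulkKerrCaptureC2_iff_family :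
    BulkKerrCaptureC2 ↔ ∀ [Kerr.Facts] [Kerr.SliceFacts], CaptureC2Family (Iio 1) (0 < ·) := by
  rw [bulkKerrCaptureC2_iff_captureC2At]
  constructor
  · intro h _ _ a₁ ha₁
    obtain ⟨s, δ, hsδ⟩ := h a₁ ha₁
    exact ⟨s, δ, fun M _ hM ↦ hsδ M hM⟩
  · intro h _ _ a₁ ha₁
    obtain ⟨s, δ, hsδ⟩ := h a₁ ha₁
    exact ⟨s, δ, fun M hM ↦ hsδ M hM.le hM⟩

/-- Every member below the crux is implied by it. [folklore] -/
theorem captureC2Family_of_bulkKerrCaptureC2 (h : BulkKerrCaptureC2) [Kerr.Facts]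
    [Kerr.SliceFacts] {T : Set ℝ} {P : ℝ → Prop} (hT : T ⊆ Iio 1) (hP : ∀ M, P M → 0 < M) :
    CaptureC2Family T P :=
  (bulkKerrCaptureC2_iff_family.1 h).anti hT hP

/-- Members whose spin range is empty at every admitted mass hold vacuously (e.g. `T ⊆ Iio 0`
with `P ⊆ (0 < ·)`, or `P = ⊥`). [folklore] -/
theorem captureC2Family_of_vacuous [Kerr.Facts] [Kerr.SliceFacts] {T : Set ℝ} {P : ℝ → Prop}
    (h : ∀ a₁ ∈ T, ∀ M : ℝ, 0 ≤ M → P M → ∀ a : ℝ, ¬ |a| ≤ a₁ * M) : CaptureC2Family T P :=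
  fun a₁ ha₁ ↦ ⟨0, 0, fun M hM hPM _ _ ↦ ⟨1, one_pos, fun a ha ↦ (h a₁ ha₁ M hM hPM a ha).elim⟩⟩

/-- An MGHD of a Kerr datum from its constraint fact and Choquet-Bruhat–Geroch (re-export of
`BulkKerrCapture.Negative.exists_mghd_kerrData_of` at the leaf `r₀ = M`).
[cite: ChoquetBruhatGeroch1969CMP, Thm. 3 (p. 332)] -/
theorem exists_mghd [Kerr.Facts] [Kerr.SliceFacts] {M a : ℝ}
    (hvac : Kerr.data_isVacuumConstraintSolution M a M)
    (hMGHD : choquetBruhat_geroch_exists_mghd_cauchy) (hM : 0 ≤ M) :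
    ∃ 𝒟 : VacuumCauchyDevelopment (Kerr.data M a M hM), 𝒟.IsMaximal :=
  Negative.exists_mghd_kerrData_of hvac hMGHD hM

/-- **(A⁺) A threshold above `1` is refuted by counting.** Every member whose threshold set reaches
some `a₁ > 1` and whose mass predicate admits some `M > 0` is FALSE modulo Choquet-Bruhat–Geroch and
the constraints of the SUPER-extremal Kerr datum `Kerr.data M (a₁M) M` (`hvac`, named fact
`Kerr.data_isVacuumConstraintSolution`; unproved in the tree for `a ≠ 0`): at that centre
(distance `0`) the member predicts, for `η := (a₁ − 1)M/2`, a sub-extremal `(M', a')` within `η` of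
`(M, a₁M)`, and there is none (`not_exists_subextremal_near_of_lt`). [folklore] -/
theorem captureC2Family_false_of_one_lt [Kerr.Facts] [Kerr.SliceFacts] {T : Set ℝ}
    {P : ℝ → Prop} (hT : ∃ a₁ ∈ T, 1 < a₁) (hP : ∃ M, 0 < M ∧ P M)
    (hvac : ∀ M a : ℝ, Kerr.data_isVacuumConstraintSolution M a M)
    (hMGHD : choquetBruhat_geroch_exists_mghd_cauchy) : ¬ CaptureC2Family T P := by
  intro h
  obtain ⟨a₁, ha₁T, ha₁⟩ := hT
  obtain ⟨M, hM, hPM⟩ := hP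
  obtain ⟨s, δ, hsδ⟩ := h a₁ ha₁T
  set η : ℝ := (a₁ - 1) * M / 2 with hη_def
  have hη : 0 < η := by
    rw [hη_def]
    exact div_pos (mul_pos (by linarith) hM) two_pos
  obtain ⟨ε, hε, hcap⟩ := hsδ M hM.le hPM η hη
  have hspin : |a₁ * M| ≤ a₁ * M := (abs_of_pos (mul_pos (by linarith) hM)).le
  obtain ⟨𝒟, hmax⟩ := exists_mghd (hvac M (a₁ * M)) hMGHD hM.le
  obtain ⟨-, M', a', -, hsub, -, hpar⟩ := captureC2At_atKerrData hε (hcap _ hspin) (hvac M _) 𝒟 hmax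
  refine not_exists_subextremal_near_of_lt ?_ ⟨M', a', hsub, hpar⟩
  rw [abs_of_pos (mul_pos (by linarith) hM), hη_def]
  nlinarith

/-- **(A) The boundary threshold `a₁ = 1` is refuted only modulo `C²` Kerr-limit rigidity.** Every
member whose threshold set reaches some `a₁ ≥ 1` and whose mass predicate admits some `M > 0` is
FALSE modulo Choquet-Bruhat–Geroch, the constraints of the extremal datum `Kerr.data M M M`, and
Kerr-limit rigidity in `C²` at that datum (`BulkKerrCapture.Negative.KerrLimitRigidity 2 M _ M`:
a `C²`-limit `g_{M',a'}` of an MGHD of the datum has `M' = M`, `|a'| = |M|`): the predicted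
sub-extremal limit would be extremal. At `k = 2` rigidity is a curvature statement (the deviation
controls `Riem(Ψ^*g) − Riem(g_{M',a'})`); it is true in print and not constructible here.
[folklore] -/
theorem captureC2Family_false_of_one_le_of_rigidity [Kerr.Facts] [Kerr.SliceFacts] {T : Set ℝ}
    {P : ℝ → Prop} (hT : ∃ a₁ ∈ T, 1 ≤ a₁) (hP : ∃ M, 0 < M ∧ P M)
    (hvac : ∀ M : ℝ, Kerr.data_isVacuumConstraintSolution M M M)
    (hMGHD : choquetBruhat_geroch_exists_mghd_cauchy)
    (hrig : ∀ (M : ℝ) (hM : 0 < M), Negative.KerrLimitRigidity 2 M hM.le M) :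
    ¬ CaptureC2Family T P := by
  intro h
  obtain ⟨a₁, ha₁T, ha₁⟩ := hT
  obtain ⟨M, hM, hPM⟩ := hP
  obtain ⟨s, δ, hsδ⟩ := h a₁ ha₁T
  obtain ⟨ε, hε, hcap⟩ := hsδ M hM.le hPM 1 one_pos
  have hspin : |M| ≤ a₁ * M := by
    rw [abs_of_pos hM]
    nlinarith
  obtain ⟨𝒟, hmax⟩ := exists_mghd (hvac M) hMGHD hM.le
  obtain ⟨-, M', a', 𝒟oc, hsub, hconv, -⟩ := captureC2At_atKerrData hε (hcap M hspin) (hvac M) 𝒟 hmax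
  obtain ⟨hM', ha'⟩ := hrig M hM 𝒟 hmax M' a' 𝒟oc 2 le_rfl hsub hconv
  unfold Kerr.IsSubextremal at hsub
  rw [ha', hM', abs_of_pos hM] at hsub
  exact lt_irrefl _ hsub

/-- **(B) The massless member is refuted only modulo `C²` Kerr-limit rigidity.** Every member whose
mass predicate admits `M = 0` and whose threshold set reaches some `a₁ ≥ 0` is FALSE modulo
Choquet-Bruhat–Geroch ALONE on the existence side (the constraints of the flat punctured datum
`Kerr.data 0 0 0` are the tree theorem `Kerr.data_isVacuumConstraintSolution_zero`) and Kerr-limit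
rigidity in `C²` at that datum (`KerrLimitRigidity 2 0 _ 0`: no MGHD of the flat datum
`C²`-converges to a sub-extremal Kerr exterior, all of which have `M' > 0` and nonzero curvature):
the member predicts such a limit with `M' ≤ η`. [folklore] -/
theorem captureC2Family_false_of_mass_zero_of_rigidity [Kerr.Facts] [Kerr.SliceFacts] {T : Set ℝ}
    {P : ℝ → Prop} (hT : ∃ a₁ ∈ T, 0 ≤ a₁) (hP : P 0)
    (hMGHD : choquetBruhat_geroch_exists_mghd_cauchy)
    (hrig : Negative.KerrLimitRigidity 2 0 le_rfl 0) : ¬ CaptureC2Family T P := by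
  intro h
  obtain ⟨a₁, ha₁T, ha₁⟩ := hT
  obtain ⟨s, δ, hsδ⟩ := h a₁ ha₁T
  obtain ⟨ε, hε, hcap⟩ := hsδ 0 le_rfl hP 1 one_pos
  have hspin : |(0 : ℝ)| ≤ a₁ * 0 := by simp
  obtain ⟨𝒟, hmax⟩ :=
    exists_mghd (Kerr.data_isVacuumConstraintSolution_zero 0 0) hMGHD le_rfl
  obtain ⟨-, M', a', 𝒟oc, hsub, hconv, -⟩ :=
    captureC2At_atKerrData hε (hcap 0 hspin) (Kerr.data_isVacuumConstraintSolution_zero 0 0) 𝒟 hmax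
  obtain ⟨hM', ha'⟩ := hrig 𝒟 hmax M' a' 𝒟oc 2 le_rfl hsub hconv
  unfold Kerr.IsSubextremal at hsub
  rw [ha', hM', abs_zero] at hsub
  exact lt_irrefl _ hsub

/-- **Summary of §5.** Granted Choquet-Bruhat–Geroch, the Kerr-data constraints and `C²`
Kerr-limit rigidity at the extremal and flat centres, both one-hypothesis weakenings of the crux —
closed spin range `a₁ ≤ 1`, non-negative mass `0 ≤ M` — are false, while the crux implies every
member below it: any proof of `BulkKerrCaptureC2` must use the strict gap `a₁ < 1` and `0 < M`.
[folklore] -/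
theorem strengthenings_fail_of_rigidity [Kerr.Facts] [Kerr.SliceFacts]
    (hvac : ∀ M a : ℝ, Kerr.data_isVacuumConstraintSolution M a M)
    (hMGHD : choquetBruhat_geroch_exists_mghd_cauchy)
    (hrig₁ : ∀ (M : ℝ) (hM : 0 < M), Negative.KerrLimitRigidity 2 M hM.le M)
    (hrig₀ : Negative.KerrLimitRigidity 2 0 le_rfl 0) :
    ¬ CaptureC2Family (Iic 1) (0 < ·) ∧ ¬ CaptureC2Family (Iio 1) (0 ≤ ·) :=
  ⟨captureC2Family_false_of_one_le_of_rigidity ⟨1, self_mem_Iic, le_rfl⟩ ⟨1, one_pos, one_pos⟩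
      (fun M ↦ hvac M M) hMGHD hrig₁,
    captureC2Family_false_of_mass_zero_of_rigidity ⟨0, by norm_num, le_rfl⟩ le_rfl hMGHD hrig₀⟩

/-! ## §6 Kill templates: the honest shape of a refutation of the crux -/

/-- **Kill template (general centre).** ONE maximal vacuum Cauchy development of ONE exact
sub-extremal Kerr datum `Kerr.data M a M` (`0 < M`, `|a| < M`) which is not far-complete, or which
for some tolerance `η > 0` has no region `C²`-converging to any `η`-close sub-extremal Kerr
exterior, refutes the crux outright (threshold `a₁ := |a|/M`). The constraints of the datum enter
as `hvac`. Such a development is not expected to exist (Hintz, arXiv:2606.28253, Thm. 13.1 claims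
the opposite on the whole sub-extremal range) and none is constructible here (Choquet-Bruhat–Geroch
is a named fact). [folklore] -/
theorem not_bulkKerrCaptureC2_of_kerrData_mghd [Kerr.Facts] [Kerr.SliceFacts] {M a : ℝ}
    (hM : 0 < M) (ha : Kerr.IsSubextremal M a)
    (hvac : ∀ M a r₀ : ℝ, Kerr.data_isVacuumConstraintSolution M a r₀)
    (𝒟 : VacuumCauchyDevelopment (Kerr.data M a M hM.le)) (hmax : 𝒟.IsMaximal)
    (hbad : ¬ 𝒟.HasCompleteFutureNullInfinityFar ∨
      ∃ η > (0 : ℝ), ∀ (M' a' : ℝ) (𝒟oc : Set 𝒟.carrier), Kerr.IsSubextremal M' a' →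
        𝒟.toSpacetime.ConvergesToKerr 𝒟oc M' a' 2 → η < |M' - M| + |a' - a|) :
    ¬ BulkKerrCaptureC2 := by
  intro h
  obtain ⟨hfar, hcap⟩ := bulkKerrCaptureC2_atKerrData h hvac hM ha 𝒟 hmax
  rcases hbad with hnot | ⟨η, hη, hno⟩
  · exact hnot hfar
  · obtain ⟨M', a', 𝒟oc, hsub, hconv, hpar⟩ := hcap η hη
    exact (hno M' a' 𝒟oc hsub hconv).not_ge hpar

/-- **Kill template (Schwarzschild centre), no named-fact hypothesis**: one bad MGHD of the
Schwarzschild datum on `{t* = 0, r > M}` refutes the crux (constraints are the tree theorem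
`Kerr.data_isVacuumConstraintSolution_zero`). Refuting the crux this way means exhibiting a
maximal development of exact Schwarzschild data that does NOT settle to any nearby slowly
rotating Kerr in `C²` — the negation of the refereed Klainerman–Szeftel / DHRT theorems in the
tree's consequence form. [folklore] -/
theorem not_bulkKerrCaptureC2_of_schwarzschild_mghd [Kerr.Facts] [Kerr.SliceFacts] {M : ℝ}
    (hM : 0 < M) (𝒟 : VacuumCauchyDevelopment (Kerr.data M 0 M hM.le)) (hmax : 𝒟.IsMaximal)
    (hbad : ¬ 𝒟.HasCompleteFutureNullInfinityFar ∨
      ∃ η > (0 : ℝ), ∀ (M' a' : ℝ) (𝒟oc : Set 𝒟.carrier), Kerr.IsSubextremal M' a' →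
        𝒟.toSpacetime.ConvergesToKerr 𝒟oc M' a' 2 → η < |M' - M| + |a' - 0|) :
    ¬ BulkKerrCaptureC2 := by
  intro h
  obtain ⟨hfar, hcap⟩ := bulkKerrCaptureC2_atSchwarzschildData h hM 𝒟 hmax
  rcases hbad with hnot | ⟨η, hη, hno⟩
  · exact hnot hfar
  · obtain ⟨M', a', 𝒟oc, hsub, hconv, hpar⟩ := hcap η hη
    exact (hno M' a' 𝒟oc hsub hconv).not_ge hpar

/-- **What a disproof must show.** Granted the two instance facts, `¬ BulkKerrCaptureC2` iff for
SOME threshold `a₁ ∈ [0, 1)` and EVERY `(s, δ)` there are a mass `M > 0` and a tolerance `η > 0`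
such that EVERY basin `ε > 0` contains a bad spin: b-conormal, `ε`-close vacuum data with a maximal
development violating the `C²`-capture conclusion. A kill must therefore defeat every Sobolev order
and every decay weight at once. [folklore] -/
theorem not_bulkKerrCaptureC2_iff [hF : Kerr.Facts] [hS : Kerr.SliceFacts] :
    ¬ BulkKerrCaptureC2 ↔
      ∃ a₁ : ℝ, 0 ≤ a₁ ∧ a₁ < 1 ∧ ∀ (s : ℕ) (δ : ℝ), ∃ (M : ℝ) (hM : 0 < M), ∃ η > (0 : ℝ),
        ∀ ε > (0 : ℝ), ∃ a : ℝ, |a| ≤ a₁ * M ∧ ¬ CaptureC2At s δ M hM.le ε η a := by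
  rw [bulkKerrCaptureC2_iff_nonneg]
  constructor
  · intro h
    by_contra hcon
    push Not at hcon
    exact h fun {_ _} a₁ h0 ha₁ ↦ by
      obtain ⟨s, δ, hsδ⟩ := hcon a₁ h0 ha₁
      exact ⟨s, δ, fun M hM η hη ↦ by
        obtain ⟨ε, hε, hcap⟩ := hsδ M hM η hη
        exact ⟨ε, hε, fun a ha ↦ by
          have := hcap a ha
          convert this⟩⟩
  · rintro ⟨a₁, h0, ha₁, h⟩ h'
    obtain ⟨s, δ, hsδ⟩ := @h' hF hS a₁ h0 ha₁
    obtain ⟨M, hM, η, hη, hbad⟩ := h s δ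
    obtain ⟨ε, hε, hcap⟩ := hsδ M hM η hη
    obtain ⟨a, ha, hna⟩ := hbad ε hε
    exact hna (hcap a ha)


/-! ## §7 Line `SketchStandalone` (= `all-orders-lebesgue-port`): the stubs and joint sufficiency -/

/-- **Stub 1 is the named claim, definitionally.** The registered signature of
`stub_hintzClaimAllOrders` (the claim BODY under the instance binder) and the NAMED claim
`Literature.Geometry.Lorentzian.hintz_kerr_stability_subextremal_cauchy_allOrders` under the same
binder are the same proposition (`Iff.rfl`): the skeleton's composition
`BulkKerrCaptureC2_of := bulkKerrCaptureC2_iff.2 (stub_c2Far_of_allOrdersBody stub_hintzClaimAllOrders)`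
closes the crux modulo EXACTLY the claim-tagged fact — no gap is smuggled, and nothing weaker than
the claim is consumed either. [cite: Hintz2026, Thm. 13.1 (pp. 318–319)] -/
theorem stub1_iff_claim :
    (∀ [Kerr.Facts] [Kerr.SliceFacts],
      ∀ χ₀ : ℝ, |χ₀| < 1 → ∀ ρ₀ ∈ Set.Ioo (1 - √(1 - χ₀ ^ 2)) (1 + √(1 - χ₀ ^ 2)),
        ∃ (s : ℕ) (δ : ℝ), ∃ ς > (0 : ℝ), ∀ (M : ℝ) (hM : 0 < M), ∀ η > (0 : ℝ), ∃ ε > (0 : ℝ),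
          ∀ a r₀ : ℝ, |a / M - χ₀| < ς → r₀ = ρ₀ * M →
            r₀ ∈ Set.Ioo (Kerr.rMinus M a) (Kerr.rPlus M a) →
            ∀ (D : InitialDataSet 𝓘(ℝ, E3) (Kerr.slice a r₀)) [D.metric.HasLeviCivita],
              D.IsVacuumConstraintSolution →
              (∀ s' : ℕ,
                InitialDataSet.dataWeightedSobolevEDist s' δ D (Kerr.data M a r₀ hM.le) < ⊤) →
              InitialDataSet.dataWeightedSobolevEDist s δ D (Kerr.data M a r₀ hM.le) <
                ENNReal.ofReal ε →
              ∀ 𝒟 : VacuumCauchyDevelopment D, 𝒟.IsMaximal →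
                ∃ (M' a' : ℝ) (𝒟oc : Set 𝒟.carrier), Kerr.IsSubextremal M' a' ∧
                  |M' - M| + |a' - a| ≤ η ∧
                  𝒟.HasCompleteFutureNullInfinityFar ∧
                  ∀ k : ℕ, 𝒟.toSpacetime.ConvergesToKerr 𝒟oc M' a' k) ↔
    ∀ [Kerr.Facts] [Kerr.SliceFacts], hintz_kerr_stability_subextremal_cauchy_allOrders :=
  Iff.rfl

/-- **The crux from the NAMED claim** (the line, end to end, over tree names): the landed stub 2
(`Theorems.bulkKerrCaptureC2_of_allOrdersBody`, p96721) applied to the named claim. CONDITIONAL on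
Hintz's unrefereed claim; closes the item only by a `_holds` discharge of it.
[cite: Hintz2026, Thm. 13.1 (pp. 318–319)] -/
theorem bulkKerrCaptureC2_of_claim
    (hclaim : ∀ [Kerr.Facts] [Kerr.SliceFacts], hintz_kerr_stability_subextremal_cauchy_allOrders) :
    BulkKerrCaptureC2 :=
  Theorems.bulkKerrCaptureC2_of_allOrdersBody (stub1_iff_claim.2 hclaim)

/-- **The crux implies the pointwise `k = 2` claim shape at the unit leaf.** For each `M > 0` and
`|a| < M` separately (threshold `a₁ := |a|/M`), `BulkKerrCaptureC2` yields `(s, δ)` and, per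
tolerance, a basin — verbatim the conclusion of
`hintz_kerr_stability_subextremal_cauchy_allOrders.orderTwo` at `r₀ = M`. So the crux sits
between the claim at `ρ₀ = 1` (all orders, locally uniform in the spin) and its pointwise `k = 2`
instance; its only content beyond the latter is local uniformity of `(s, δ, ε)` in `a`
(Hintz's Remark 13.2). [folklore] -/
theorem bulkKerrCaptureC2_pointwise (h : BulkKerrCaptureC2) [Kerr.Facts] [Kerr.SliceFacts]
    {M a : ℝ} (hM : 0 < M) (ha : Kerr.IsSubextremal M a) :
    ∃ (s : ℕ) (δ : ℝ), ∀ η > (0 : ℝ), ∃ ε > (0 : ℝ),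
      ∀ (D : InitialDataSet 𝓘(ℝ, E3) (Kerr.slice a M)) [D.metric.HasLeviCivita],
        D.IsVacuumConstraintSolution →
        (∀ s' : ℕ,
          InitialDataSet.dataWeightedSobolevEDist s' δ D (Kerr.data M a M hM.le) < ⊤) →
        InitialDataSet.dataWeightedSobolevEDist s δ D (Kerr.data M a M hM.le) <
          ENNReal.ofReal ε →
        ∀ 𝒟 : VacuumCauchyDevelopment D, 𝒟.IsMaximal →
          ∃ (M' a' : ℝ) (𝒟oc : Set 𝒟.carrier), Kerr.IsSubextremal M' a' ∧
            |M' - M| + |a' - a| ≤ η ∧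
            𝒟.HasCompleteFutureNullInfinityFar ∧
            𝒟.toSpacetime.ConvergesToKerr 𝒟oc M' a' 2 := by
  rw [bulkKerrCaptureC2_iff_captureC2At] at h
  have ha₁ : |a| / M < 1 := by
    rw [div_lt_one hM]
    exact ha
  obtain ⟨s, δ, hsδ⟩ := h (|a| / M) ha₁
  have hspin : |a| ≤ |a| / M * M := by rw [div_mul_cancel₀ _ hM.ne']
  refine ⟨s, δ, fun η hη ↦ ?_⟩
  obtain ⟨ε, hε, hcap⟩ := hsδ M hM η hη
  refine ⟨ε, hε, fun D _ hvac hcon hdist 𝒟 hmax ↦ ?_⟩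
  obtain ⟨M', a', 𝒟oc, hsub, hfar, hconv, hpar⟩ := hcap a hspin D hvac hcon hdist 𝒟 hmax
  exact ⟨M', a', 𝒟oc, hsub, hpar, hfar, hconv⟩

/-! ## §8 Near-miss: `C²` Kerr-limit rigidity (what would make §5 unconditional modulo CBG) -/

/-- **NEAR-MISS (not proved): Kerr-limit rigidity in `C²` at the Kerr–Schild leaf.** For `0 < M`,
`|a| ≤ M`: every sub-extremal `g_{M',a'}` to which some region of some MGHD of `Kerr.data M a M`
converges in `Cᵏ`, `k ≥ 2`, has `M' = M` and `|a'| = |a|`. TRUE IN PRINT (a `C²`-convergent late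
chart makes `Ψ` an asymptotic isometry up to second derivatives, so curvature invariants and the
asymptotic mass/angular-momentum aspects of the slabs must match; at the extremal member this is
also what Aretakis' conservation law forbids). OBSTRUCTION to a Lean proof, each item absent from
the tree: (i) naturality of the Riemann tensor under pullback by a smooth open embedding, in the
`PseudoRiemannianMetric`/`leviCivitaFun` formalism, with continuity of `(g, ∂g, ∂²g) ↦ Riem` in the
`supCkENorm` topology; (ii) `Riem(g_{M',a'}) ≠ 0` somewhere on every slab, quantitatively, for ALL
sub-extremal `(M', a')` (explicit Kerr curvature in Kerr–Schild Cartesian coordinates); (iii) the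
geometry of an ABSTRACT maximal development of the datum (CBG uniqueness + identification of the
Kerr MGHD of the leaf `{t* = 0, r > M}`), since `KerrLimitRigidity` quantifies over all of them.
With this lemma, `captureC2Family_false_of_one_le_of_rigidity` /
`captureC2Family_false_of_mass_zero_of_rigidity` (§5) become refutations of the closed-range and
massless members modulo CBG and the Kerr-data constraints alone, as for the predecessor crux.
Tried: nothing beyond the reduction — (i)–(iii) are each larger than a cycle. [folklore] -/
theorem kerrLimitRigidity_two [Kerr.Facts] [Kerr.SliceFacts] {M a : ℝ} (hM : 0 < M)
    (ha : |a| ≤ M) : Negative.KerrLimitRigidity 2 M hM.le a := by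
  sorry

end Summit.FinalStateConjecture.FinalStateConjecture.Cruxes.BulkKerrCaptureC2.Disproof

end
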